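import Literature.AlgebraicGeometry.ModuliOfAbelianVarieties.SiegelFamilyRealCohomologyDoubleCosets
import HarnessLib

/-!
# Goresky–Tai's Theorem 8, elementwise: the `Γ(4m)`-real locus is `S = ⋃_{β ∈ Γ_{2m}(2)} β · iC_g`, two slices
# `g₁ · iC_g`, `g₂ · iC_g` meet the same `Γ(4m)`-orbits iff `Γ(4m) g₁ Γ_ℓ(2) = Γ(4m) g₂ Γ_ℓ(2)`, and inside one slice
# the `Γ(4m)`-identifications are exactly `ᵍΓ_ℓ(4m) = gΓ_ℓ(4m)g⁻¹`
# (Goresky–Tai 2003, §4.1 Theorem 8 and its proof §4.6)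

Topic `Literature/AlgebraicGeometry/ModuliOfAbelianVarieties` (the Siegel-family files, namespace
`Literature.AlgebraicGeometry.ModuliOfAbelianVarieties.SiegelModuli`).  Lane `lit-hodgefound` (Track 2
foundations library), prover seat p15 generation 52, row g52-#6, on top of g52-#5 `SiegelFamilyRealCohomologyDoubleCosets`
(Lemma 7 elementwise, Lemma 12), g52-#4 (Lemma 9 (3) and its converse, Cor. 11 as printed), g51-#5
(`𝔥_g^{τ(h)h⁻¹} = h · iC_g`), g51-#6 (free action; Prop. 6 (1) ⟹ (2) at level `q ≥ 3`).  THEOREMS ONLY: no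
definition, no instance, no notation, no named fact (net Literature debt `0`), no `sorry`.  Conventions as in
g52-#4/#5: `Γ_{2m}(2)` = the four block congruences, `Γ_ℓ(N) ↪ Sp` = block-diagonal `(P 0; 0 Q) ∈ Sp_{2g}(ℤ)`
(`ᵗPQ = 1`) with `P ≡ Q ≡ I (mod N)`, the slice `g · iC_g = {Ω : Re(g⁻¹ • Ω) = 0}`, `X = Γ(4m)∖𝔥_g`.

## Source, VERBATIM

M. Goresky, Y. S. Tai, *The moduli space of real abelian varieties with level structure*, Compositio
Math. **139** (2003) = arXiv:math/0108103, held `paper:arxiv-math_0108103`.  §4.1 p0007: «Define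
`S = ⋃_{γ ∈ Γ(4m)} 𝔥_n^γ ⊂ 𝔥_n` to be the set of all `Γ(4m)`-real points in `𝔥_n`.  Denote by `Γ(4m)∖S` the
image of `S` in `X = Γ(4m)∖𝔥_n`.  For `g ∈ Γ_{2m}(2)` set `ᵍΓ_ℓ(4m) = gΓ_ℓ(4m)g⁻¹`. … **Theorem 8.** The set `X_ℝ`
of real points of `X` is precisely `Γ(4m)∖S`.  It consists of the disjoint union
`X_ℝ = ∐_g ᵍΓ_ℓ(4m)∖giC_n` of finitely many copies of `Γ_ℓ(4m)∖C_n`, indexed by elements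
`g ∈ Γ(4m)∖Γ_{2m}(2)/Γ_ℓ(2) = H¹(ℂ/ℝ, Γ(4m))`.  The copy indexed by `g ∈ Γ_{2m}(2)` corresponds to the
cohomology class of `f_γ` where `γ = g̃g⁻¹ ∈ Γ(4m)`.»  «In order to identify the set of real points `X_ℝ` we
will make repeated use of the following observation: the image `[Z] ∈ X` of a point `Z ∈ 𝔥_n` lies in `X_ℝ`
iff there exists `γ ∈ Γ(4m)` such that `γZ = −Z̄` (i.e. such that `Z ∈ 𝔥_n^γ`).»  §4.6 p0008: «4.6 Proof of
Theorem 8.  For `γ ∈ Γ(4m)` define `X^γ ⊂ X = Γ(4m)∖𝔥_n` to be the image of `𝔥_n^γ` in `X`.  For each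
`g ∈ Γ_{2m}(2)` the corresponding element `γ = τ(g)g⁻¹` lies in `Γ(4m)`, and `𝔥_n^γ = giC_n`.  (This follows from
lemma 9 and Proposition 6.)  The resulting mapping `⋃_{g ∈ Γ_{2m}(2)} giC_n ⟶ ⋃_{γ ∈ Γ(4m)} 𝔥_n^γ` is
surjective by Corollary 11.  For each `g ∈ Γ_{2m}(2)` the composition `giC_n → 𝔥_n^γ → X^γ` is surjective and
induces an isomorphism `ᵍΓ_ℓ(4m)∖giC_n → X^γ` (where `ᵍΓ_ℓ(4m) = gΓ_ℓ(4m)g⁻¹`.)  By lemma 12 this determines a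
bijection `∐_{g ∈ Γ(4m)∖Γ_{2m}(2)/Γ_ℓ(2)} ᵍΓ_ℓ(4m)∖giC_n ⟶ Γ(4m)∖⋃_{γ ∈ Γ(4m)} 𝔥_n^γ = X_ℝ`.»

## What is proved (`g ≥ 1` where Cor. 11 is used, `m ≥ 1` throughout)

* §1 **`exists_mem_siegelPrincipalGamma_smul_eq_negConj_iff_exists_gammaTwoM`** — `S = ⋃_{β ∈ Γ_{2m}(2)} β · iC_g`:
  `Ω ∈ 𝔥_g` is `Γ_g(4m)`-real (`∃ γ ∈ Γ(4m)`, `γ • Ω = τΩ`) iff `Re(β⁻¹ • Ω) = 0` for some `β ∈ Γ_{2m}(2)` («The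
  resulting mapping … is surjective by Corollary 11»; ⟸: `γ = τ(β)β⁻¹ ∈ Γ(4m)`, `𝔥_g^γ = β · iC_g`).
* §2 **`map_re_smul_eq_zero_of_coe_eq_mul_mul_fromBlocks`** — the map (4.2) is well defined on double cosets:
  if `g₂ = δg₁α` with `α` block diagonal then `δ` carries `g₁ · iC_g` into `g₂ · iC_g` (for `δ ∈ Γ(4m)`: the two
  slices have the same image in `X`); with Lemma 12 (g52-#5) this gives
  **`exists_smul_mem_slice_iff_exists_eq_mul_mul_fromBlocks`**: the images of `g₁ · iC_g` and `g₂ · iC_g`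
  (`g_i ∈ Γ_{2m}(2)`) in `X = Γ(4m)∖𝔥_g` meet iff `g₂ ∈ Γ(4m) g₁ Γ_ℓ(2)` — the index set of (4.2) is
  `Γ(4m)∖Γ_{2m}(2)/Γ_ℓ(2)`.
* §3 the fibres — «induces an isomorphism `ᵍΓ_ℓ(4m)∖giC_n → X^γ`»: `mem_siegelPrincipalGamma_of_coe_eq_fromBlocks`
  (block-diagonal `(P 0; 0 Q)` with `P ≡ Q ≡ I (mod q)` lies in `Γ(q)`),
  **`exists_coe_conj_eq_fromBlocks_of_map_re_smul_eq_zero`** (`β ∈ Γ_{2m}(2)`, `δ ∈ Γ(4m)`, `Z` and `δZ` both in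
  `β · iC_g ⟹ β⁻¹δβ = (P 0; 0 Q)` with `ᵗPQ = 1`, `P ≡ Q ≡ I (mod 4m)`, i.e. `δ ∈ βΓ_ℓ(4m)β⁻¹`), and the converse
  **`conj_mem_siegelPrincipalGamma_and_map_re_smul_eq_zero`** (every `δ = βuβ⁻¹`, `u ∈ Γ_ℓ(4m)`, lies in
  `Γ(4m)` and preserves `β · iC_g`).

## References

* [GoreskyTai2003RealModuli] M. Goresky, Y. S. Tai, Compositio Math. 139 (2003) 1–27 (arXiv:math/0108103),
  §4.1 Theorem 8, (4.2), §4.6.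
-/

noncomputable section

open scoped Matrix ComplexConjugate
open Matrix Function

namespace Literature.AlgebraicGeometry.ModuliOfAbelianVarieties

namespace SiegelModuli

open Literature.NumberTheory.Automorphic (siegelUpperHalfSpace)
open Literature.NumberTheory.ModularForms.SiegelUpperHalfSpace (symplecticIntHom siegelModularGroup
  symplecticIntHom_injective pointI)
open Literature.NumberTheory.ModularForms.SiegelModularForm (siegelPrincipalGamma mem_siegelPrincipalGamma_iff
  siegelPrincipalGamma_anti normal_siegelPrincipalGamma)

variable {g : ℕ}

/-! ## §1 `S = ⋃_{γ ∈ Γ(4m)} 𝔥_g^γ = ⋃_{β ∈ Γ_{2m}(2)} β · iC_g` -/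

/-- **THEOREM 8, the set `S`**: for `g ≥ 1`, `m ≥ 1` and `Ω ∈ 𝔥_g`, «there exists `γ ∈ Γ(4m)` such that
`γZ = −Z̄`» iff `Ω ∈ β · iC_g` (`Re(β⁻¹ • Ω) = 0`) for some `β ∈ Γ_{2m}(2)` — «The resulting mapping
`⋃_{g ∈ Γ_{2m}(2)} giC_n ⟶ ⋃_{γ ∈ Γ(4m)} 𝔥_n^γ` is surjective by Corollary 11» (⟹, Cor. 11 of g52-#4), and «for
each `g ∈ Γ_{2m}(2)` the corresponding element `γ = τ(g)g⁻¹` lies in `Γ(4m)`, and `𝔥_n^γ = giC_n`» (⟸, Lemma 9 (3)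
converse and g51-#5). [cite: GoreskyTai2003RealModuli, §4.1 Theorem 8 («`X_ℝ` is precisely `Γ(4m)∖S`») and §4.6] -/
theorem exists_mem_siegelPrincipalGamma_smul_eq_negConj_iff_exists_gammaTwoM (hg : 0 < g) {m : ℕ} (hm : 0 < m)
    (Ω : siegelUpperHalfSpace g) :
    (∃ γ ∈ siegelPrincipalGamma g (4 * m),
        symplecticIntHom g γ • Ω = ⟨-(Ω : Matrix (Fin g) (Fin g) ℂ).map conj, neg_map_conj_mem_siegelUpperHalfSpace Ω.2⟩) ↔
      ∃ β : Matrix.symplecticGroup (Fin g) ℤ,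
        ((β : Matrix (Fin g ⊕ Fin g) (Fin g ⊕ Fin g) ℤ).toBlocks₁₁.map (Int.castRingHom (ZMod 2)) = 1 ∧
          (β : Matrix (Fin g ⊕ Fin g) (Fin g ⊕ Fin g) ℤ).toBlocks₂₂.map (Int.castRingHom (ZMod 2)) = 1 ∧
          (β : Matrix (Fin g ⊕ Fin g) (Fin g ⊕ Fin g) ℤ).toBlocks₁₂.map (Int.castRingHom (ZMod (2 * m))) = 0 ∧
          (β : Matrix (Fin g ⊕ Fin g) (Fin g ⊕ Fin g) ℤ).toBlocks₂₁.map (Int.castRingHom (ZMod (2 * m))) = 0) ∧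
        (((symplecticIntHom g β)⁻¹ • Ω : siegelUpperHalfSpace g) : Matrix (Fin g) (Fin g) ℂ).map Complex.re = 0 := by
  constructor
  · rintro ⟨γ, hγ, hΩ⟩
    obtain ⟨β, hβ, -, hlocus⟩ :=
      exists_gammaTwoM_eq_conjK_mul_inv_of_mem_siegelPrincipalGamma_four_mul hg hm hγ ⟨Ω, hΩ⟩
    exact ⟨β, hβ, (hlocus Ω).1 hΩ⟩
  · rintro ⟨β, hβ, hre⟩
    refine ⟨_, conjK_mul_inv_mem_siegelPrincipalGamma_of_toBlocks hβ.2.2.1 hβ.2.2.2, ?_⟩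
    rw [map_mul, map_inv, symplecticIntHom_conjK]
    exact (smul_eq_negConj_iff_of_coboundary (symplecticIntHom g β) Ω).2 hre

/-! ## §2 The slices `g · iC_g`, `g ∈ Γ_{2m}(2)`, are indexed in `X = Γ(4m)∖𝔥_g` by `Γ(4m)∖Γ_{2m}(2)/Γ_ℓ(2)` -/

/-- The matrix of `(δg₁)⁻¹g₂` when `g₂ = δg₁α` on matrices. [folklore] -/
private theorem coe_inv_mul_eq_of_coe_eq_g52f {g₁ g₂ δ : Matrix.symplecticGroup (Fin g) ℤ}
    {F : Matrix (Fin g ⊕ Fin g) (Fin g ⊕ Fin g) ℤ}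
    (h : (g₂ : Matrix (Fin g ⊕ Fin g) (Fin g ⊕ Fin g) ℤ) =
      (δ : Matrix (Fin g ⊕ Fin g) (Fin g ⊕ Fin g) ℤ) * (g₁ : Matrix (Fin g ⊕ Fin g) (Fin g ⊕ Fin g) ℤ) * F) :
    (((δ * g₁)⁻¹ * g₂ : Matrix.symplecticGroup (Fin g) ℤ) : Matrix (Fin g ⊕ Fin g) (Fin g ⊕ Fin g) ℤ) = F := by
  have e : (g₂ : Matrix (Fin g ⊕ Fin g) (Fin g ⊕ Fin g) ℤ) =
      ((δ * g₁ : Matrix.symplecticGroup (Fin g) ℤ) : Matrix (Fin g ⊕ Fin g) (Fin g ⊕ Fin g) ℤ) * F := h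
  change (((δ * g₁)⁻¹ : Matrix.symplecticGroup (Fin g) ℤ) : Matrix (Fin g ⊕ Fin g) (Fin g ⊕ Fin g) ℤ) *
      (g₂ : Matrix (Fin g ⊕ Fin g) (Fin g ⊕ Fin g) ℤ) = F
  rw [e, ← Matrix.mul_assoc]
  change (((δ * g₁)⁻¹ * (δ * g₁) : Matrix.symplecticGroup (Fin g) ℤ) : Matrix (Fin g ⊕ Fin g) (Fin g ⊕ Fin g) ℤ) * F = F
  rw [inv_mul_cancel]
  change (1 : Matrix (Fin g ⊕ Fin g) (Fin g ⊕ Fin g) ℤ) * F = F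
  rw [Matrix.one_mul]

/-- **The map (4.2) is well defined on double cosets `Γ(4m) g Γ_ℓ(2)`**: if `g₂ = δg₁α` in `Sp_{2g}(ℤ)` with `α`
block diagonal (`τ(α) = α`, the embedded `GL(g, ℤ)`), then `δ` carries the slice `g₁ · iC_g` into `g₂ · iC_g`:
`Re(g₁⁻¹ • Z) = 0 ⟹ Re(g₂⁻¹ • δZ) = 0` (because `τ(g₂)g₂⁻¹ = τ(δ) · τ(g₁)g₁⁻¹ · δ⁻¹`, g52-#5, and
`𝔥_g^{τ(h)h⁻¹} = h · iC_g`, g51-#5).  For `δ ∈ Γ(4m)` the two slices therefore have the same image in `X`.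
[cite: GoreskyTai2003RealModuli, §4.1 Theorem 8 («indexed by elements `g ∈ Γ(4m)∖Γ_{2m}(2)/Γ_ℓ(2)`») and §4.6] -/
theorem map_re_smul_eq_zero_of_coe_eq_mul_mul_fromBlocks {g₁ g₂ δ : Matrix.symplecticGroup (Fin g) ℤ}
    {P Q : Matrix (Fin g) (Fin g) ℤ}
    (h : (g₂ : Matrix (Fin g ⊕ Fin g) (Fin g ⊕ Fin g) ℤ) =
      (δ : Matrix (Fin g ⊕ Fin g) (Fin g ⊕ Fin g) ℤ) * (g₁ : Matrix (Fin g ⊕ Fin g) (Fin g ⊕ Fin g) ℤ) *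
        Matrix.fromBlocks P 0 0 Q)
    {Z : siegelUpperHalfSpace g}
    (hZ : (((symplecticIntHom g g₁)⁻¹ • Z : siegelUpperHalfSpace g) : Matrix (Fin g) (Fin g) ℂ).map Complex.re = 0) :
    (((symplecticIntHom g g₂)⁻¹ • (symplecticIntHom g δ • Z) : siegelUpperHalfSpace g) : Matrix (Fin g) (Fin g) ℂ).map
        Complex.re = 0 := by
  have hu := coe_inv_mul_eq_of_coe_eq_g52f h
  have key := conjK_mk_mul_inv_of_mul_mul δ g₁ ((δ * g₁)⁻¹ * g₂) hu
  rw [mul_inv_cancel_left] at key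
  have keyR := congrArg (symplecticIntHom g) key
  simp only [map_mul, map_inv, symplecticIntHom_conjK] at keyR
  have hZ' := (smul_eq_negConj_iff_of_coboundary (symplecticIntHom g g₁) Z).2 hZ
  refine (smul_eq_negConj_iff_of_coboundary (symplecticIntHom g g₂) (symplecticIntHom g δ • Z)).1 ?_
  rw [keyR, mul_smul, mul_smul, inv_smul_smul, hZ', iStar_smul_negConj]

/-- **The slices are INDEXED BY `Γ(4m)∖Γ_{2m}(2)/Γ_ℓ(2)`** (`m ≥ 1`): for `g₁, g₂ ∈ Γ_{2m}(2)`, the images of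
`g₁ · iC_g` and `g₂ · iC_g` in `X = Γ(4m)∖𝔥_g` meet — some `γ ∈ Γ(4m)` carries a point of `g₁ · iC_g` to a point of
`g₂ · iC_g` — iff `g₂ = δg₁α` with `δ ∈ Γ(4m)` and `α = (P 0; 0 Q)`, `ᵗPQ = 1`, `P ≡ Q ≡ I (mod 2)` (`α ∈ Γ_ℓ(2)`):
⟹ is Lemma 12 (g52-#5), ⟸ is the well-definedness above at the point `g₁ • iI ∈ g₁ · iC_g`.
[cite: GoreskyTai2003RealModuli, §4.1 Theorem 8 and §4.6 («By lemma 12 this determines a bijection …»)] -/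
theorem exists_smul_mem_slice_iff_exists_eq_mul_mul_fromBlocks {m : ℕ} (hm : 0 < m)
    {g₁ g₂ : Matrix.symplecticGroup (Fin g) ℤ}
    (hg₁ : (g₁ : Matrix (Fin g ⊕ Fin g) (Fin g ⊕ Fin g) ℤ).toBlocks₁₁.map (Int.castRingHom (ZMod 2)) = 1 ∧
      (g₁ : Matrix (Fin g ⊕ Fin g) (Fin g ⊕ Fin g) ℤ).toBlocks₂₂.map (Int.castRingHom (ZMod 2)) = 1 ∧
      (g₁ : Matrix (Fin g ⊕ Fin g) (Fin g ⊕ Fin g) ℤ).toBlocks₁₂.map (Int.castRingHom (ZMod (2 * m))) = 0 ∧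
      (g₁ : Matrix (Fin g ⊕ Fin g) (Fin g ⊕ Fin g) ℤ).toBlocks₂₁.map (Int.castRingHom (ZMod (2 * m))) = 0)
    (hg₂ : (g₂ : Matrix (Fin g ⊕ Fin g) (Fin g ⊕ Fin g) ℤ).toBlocks₁₁.map (Int.castRingHom (ZMod 2)) = 1 ∧
      (g₂ : Matrix (Fin g ⊕ Fin g) (Fin g ⊕ Fin g) ℤ).toBlocks₂₂.map (Int.castRingHom (ZMod 2)) = 1 ∧
      (g₂ : Matrix (Fin g ⊕ Fin g) (Fin g ⊕ Fin g) ℤ).toBlocks₁₂.map (Int.castRingHom (ZMod (2 * m))) = 0 ∧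
      (g₂ : Matrix (Fin g ⊕ Fin g) (Fin g ⊕ Fin g) ℤ).toBlocks₂₁.map (Int.castRingHom (ZMod (2 * m))) = 0) :
    (∃ Z₁ Z₂ : siegelUpperHalfSpace g,
        (((symplecticIntHom g g₁)⁻¹ • Z₁ : siegelUpperHalfSpace g) : Matrix (Fin g) (Fin g) ℂ).map Complex.re = 0 ∧
        (((symplecticIntHom g g₂)⁻¹ • Z₂ : siegelUpperHalfSpace g) : Matrix (Fin g) (Fin g) ℂ).map Complex.re = 0 ∧
        ∃ γ ∈ siegelPrincipalGamma g (4 * m), symplecticIntHom g γ • Z₁ = Z₂) ↔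
      ∃ δ ∈ siegelPrincipalGamma g (4 * m), ∃ P Q : Matrix (Fin g) (Fin g) ℤ,
        Pᵀ * Q = 1 ∧ P.map (Int.castRingHom (ZMod 2)) = 1 ∧ Q.map (Int.castRingHom (ZMod 2)) = 1 ∧
        (g₂ : Matrix (Fin g ⊕ Fin g) (Fin g ⊕ Fin g) ℤ) =
          (δ : Matrix (Fin g ⊕ Fin g) (Fin g ⊕ Fin g) ℤ) * (g₁ : Matrix (Fin g ⊕ Fin g) (Fin g ⊕ Fin g) ℤ) *
            Matrix.fromBlocks P 0 0 Q := by
  constructor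
  · rintro ⟨Z₁, Z₂, hZ₁, hZ₂, γ, hγ, hγZ⟩
    exact ⟨γ, hγ, exists_eq_mul_mul_fromBlocks_of_smul_eq hm hg₁ hg₂ hγ hZ₁ hZ₂ hγZ⟩
  · rintro ⟨δ, hδ, P, Q, -, -, -, h⟩
    have hI : (((symplecticIntHom g g₁)⁻¹ • (symplecticIntHom g g₁ • pointI g) : siegelUpperHalfSpace g) :
        Matrix (Fin g) (Fin g) ℂ).map Complex.re = 0 := by
      rw [inv_smul_smul]
      exact (neg_map_conj_eq_self_iff _).1 (congrArg Subtype.val (negConj_pointI (g := g)))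
    exact ⟨symplecticIntHom g g₁ • pointI g, symplecticIntHom g δ • (symplecticIntHom g g₁ • pointI g), hI,
      map_re_smul_eq_zero_of_coe_eq_mul_mul_fromBlocks h hI, δ, hδ, rfl⟩

/-! ## §3 The fibres: `giC_n → X^γ` «induces an isomorphism `ᵍΓ_ℓ(4m)∖giC_n → X^γ`» -/

/-- A block-diagonal `(P 0; 0 Q) ∈ Sp_{2g}(ℤ)` with `P ≡ Q ≡ I (mod q)` lies in `Γ(q)` (the embedded `Γ_ℓ(q)`).
[cite: GoreskyTai2003RealModuli, §4.1 («`Γ_ℓ(N) = {γ ∈ Γ_ℓ(1) | γ ≡ I (mod N)}`») and §4.2 («`H⁰(Γ(4m)) = Γ_ℓ(4m)`»)] -/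
theorem mem_siegelPrincipalGamma_of_coe_eq_fromBlocks {q : ℕ} {u : Matrix.symplecticGroup (Fin g) ℤ}
    {P Q : Matrix (Fin g) (Fin g) ℤ} (hu : (u : Matrix (Fin g ⊕ Fin g) (Fin g ⊕ Fin g) ℤ) = Matrix.fromBlocks P 0 0 Q)
    (hP : P.map (Int.castRingHom (ZMod q)) = 1) (hQ : Q.map (Int.castRingHom (ZMod q)) = 1) :
    u ∈ siegelPrincipalGamma g q := by
  rw [mem_siegelPrincipalGamma_iff, hu, Matrix.fromBlocks_map, hP, hQ, Matrix.map_zero _ (map_zero _),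
    Matrix.fromBlocks_one]

/-- **The `Γ(4m)`-identifications inside a slice are `ᵍΓ_ℓ(4m)`**: if `β ∈ Γ_{2m}(2)`, `δ ∈ Γ(4m)`, and both `Z`
and `δZ` lie in `β · iC_g`, then `β⁻¹δβ = (P 0; 0 Q)` with `ᵗPQ = 1` and `P ≡ Q ≡ I (mod 4m)`, i.e.
`δ ∈ βΓ_ℓ(4m)β⁻¹ = ᵝΓ_ℓ(4m)` (Lemma 12 with `g₁ = g₂ = β`, then normality of `Γ(4m)`; `m ≥ 1`).
[cite: GoreskyTai2003RealModuli, §4.6 («induces an isomorphism `ᵍΓ_ℓ(4m)∖giC_n → X^γ` (where `ᵍΓ_ℓ(4m) = gΓ_ℓ(4m)g⁻¹`.)»)] -/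
theorem exists_coe_conj_eq_fromBlocks_of_map_re_smul_eq_zero {m : ℕ} (hm : 0 < m)
    {β δ : Matrix.symplecticGroup (Fin g) ℤ}
    (hβ : (β : Matrix (Fin g ⊕ Fin g) (Fin g ⊕ Fin g) ℤ).toBlocks₁₁.map (Int.castRingHom (ZMod 2)) = 1 ∧
      (β : Matrix (Fin g ⊕ Fin g) (Fin g ⊕ Fin g) ℤ).toBlocks₂₂.map (Int.castRingHom (ZMod 2)) = 1 ∧
      (β : Matrix (Fin g ⊕ Fin g) (Fin g ⊕ Fin g) ℤ).toBlocks₁₂.map (Int.castRingHom (ZMod (2 * m))) = 0 ∧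
      (β : Matrix (Fin g ⊕ Fin g) (Fin g ⊕ Fin g) ℤ).toBlocks₂₁.map (Int.castRingHom (ZMod (2 * m))) = 0)
    (hδ : δ ∈ siegelPrincipalGamma g (4 * m)) {Z : siegelUpperHalfSpace g}
    (hZ : (((symplecticIntHom g β)⁻¹ • Z : siegelUpperHalfSpace g) : Matrix (Fin g) (Fin g) ℂ).map Complex.re = 0)
    (hδZ : (((symplecticIntHom g β)⁻¹ • (symplecticIntHom g δ • Z) : siegelUpperHalfSpace g) :
      Matrix (Fin g) (Fin g) ℂ).map Complex.re = 0) :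
    ∃ P Q : Matrix (Fin g) (Fin g) ℤ, Pᵀ * Q = 1 ∧ P.map (Int.castRingHom (ZMod (4 * m))) = 1 ∧
      Q.map (Int.castRingHom (ZMod (4 * m))) = 1 ∧
      ((β⁻¹ * δ * β : Matrix.symplecticGroup (Fin g) ℤ) : Matrix (Fin g ⊕ Fin g) (Fin g ⊕ Fin g) ℤ) =
        Matrix.fromBlocks P 0 0 Q := by
  obtain ⟨P, Q, hPQ, -, -, hβeq⟩ := exists_eq_mul_mul_fromBlocks_of_smul_eq hm hβ hβ hδ hZ hδZ rfl
  have hu := coe_inv_mul_eq_of_coe_eq_g52f hβeq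
  have hw : β⁻¹ * δ * β = ((δ * β)⁻¹ * β)⁻¹ := by group
  have hcoe : ((β⁻¹ * δ * β : Matrix.symplecticGroup (Fin g) ℤ) : Matrix (Fin g ⊕ Fin g) (Fin g ⊕ Fin g) ℤ) =
      Matrix.fromBlocks Qᵀ 0 0 Pᵀ := by
    rw [hw, coe_inv_eq_fromBlocks, hu]
    simp
  have hmem : β⁻¹ * δ * β ∈ siegelPrincipalGamma g (4 * m) :=
    (normal_siegelPrincipalGamma (n := g) (q := 4 * m)).conj_mem' δ hδ β
  rw [mem_siegelPrincipalGamma_iff, hcoe, Matrix.fromBlocks_map, ← Matrix.fromBlocks_one, Matrix.fromBlocks_inj] at hmem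
  refine ⟨Qᵀ, Pᵀ, ?_, hmem.1, hmem.2.2.2, hcoe⟩
  rw [Matrix.transpose_transpose]
  exact mul_eq_one_comm.1 hPQ

/-- **Conversely, `ᵝΓ_ℓ(4m)` identifies points of `β · iC_g` inside `Γ(4m)`**: for block-diagonal
`u = (P 0; 0 Q) ∈ Sp_{2g}(ℤ)` with `P ≡ Q ≡ I (mod 4m)` (`u ∈ Γ_ℓ(4m)`), `δ = βuβ⁻¹` lies in `Γ(4m)` and carries
`β · iC_g` into itself. [cite: GoreskyTai2003RealModuli, §4.6 («induces an isomorphism `ᵍΓ_ℓ(4m)∖giC_n → X^γ`»)] -/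
theorem conj_mem_siegelPrincipalGamma_and_map_re_smul_eq_zero {m : ℕ} {β u : Matrix.symplecticGroup (Fin g) ℤ}
    {P Q : Matrix (Fin g) (Fin g) ℤ} (hu : (u : Matrix (Fin g ⊕ Fin g) (Fin g ⊕ Fin g) ℤ) = Matrix.fromBlocks P 0 0 Q)
    (hP : P.map (Int.castRingHom (ZMod (4 * m))) = 1) (hQ : Q.map (Int.castRingHom (ZMod (4 * m))) = 1)
    {Z : siegelUpperHalfSpace g}
    (hZ : (((symplecticIntHom g β)⁻¹ • Z : siegelUpperHalfSpace g) : Matrix (Fin g) (Fin g) ℂ).map Complex.re = 0) :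
    β * u * β⁻¹ ∈ siegelPrincipalGamma g (4 * m) ∧
      (((symplecticIntHom g β)⁻¹ • (symplecticIntHom g (β * u * β⁻¹) • Z) : siegelUpperHalfSpace g) :
        Matrix (Fin g) (Fin g) ℂ).map Complex.re = 0 := by
  refine ⟨(normal_siegelPrincipalGamma (n := g) (q := 4 * m)).conj_mem u
    (mem_siegelPrincipalGamma_of_coe_eq_fromBlocks hu hP hQ) β, ?_⟩
  -- `β = (βuβ⁻¹) β u⁻¹` with `u⁻¹ = (ᵗQ 0; 0 ᵗP)` block diagonal
  have hinv : ((u⁻¹ : Matrix.symplecticGroup (Fin g) ℤ) : Matrix (Fin g ⊕ Fin g) (Fin g ⊕ Fin g) ℤ) =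
      Matrix.fromBlocks Qᵀ 0 0 Pᵀ := by
    rw [coe_inv_eq_fromBlocks, hu]
    simp
  have h : (β : Matrix (Fin g ⊕ Fin g) (Fin g ⊕ Fin g) ℤ) =
      ((β * u * β⁻¹ : Matrix.symplecticGroup (Fin g) ℤ) : Matrix (Fin g ⊕ Fin g) (Fin g ⊕ Fin g) ℤ) *
        (β : Matrix (Fin g ⊕ Fin g) (Fin g ⊕ Fin g) ℤ) * Matrix.fromBlocks Qᵀ 0 0 Pᵀ := by
    rw [← hinv]
    change (β : Matrix (Fin g ⊕ Fin g) (Fin g ⊕ Fin g) ℤ) =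
      ((β * u * β⁻¹ * β * u⁻¹ : Matrix.symplecticGroup (Fin g) ℤ) : Matrix (Fin g ⊕ Fin g) (Fin g ⊕ Fin g) ℤ)
    congr 1
    group
  exact map_re_smul_eq_zero_of_coe_eq_mul_mul_fromBlocks h hZ

end SiegelModuli

end Literature.AlgebraicGeometry.ModuliOfAbelianVarieties
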